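import Mathlib.RingTheory.Ideal.Maximal
import Literature.NumberTheory.Transcendental.ExpVarieties
import Literature.RingTheory.KrullDimension.AffineDimension
import HarnessLib

/-!
# Coordinates on a set of small Zariski dimension are algebraically dependent

For a subset `W ⊆ K^ι` (`ι` finite, `K` a field) and `n` coordinates picked out by
`f : Fin n → ι`: if `zariskiDim K W < n` (Krull dimension of the coordinate ring
`K[X_ι] ⧸ I(W)` of the Zariski closure, `ExpVarieties.lean`), then the `n` coordinate functions
`z ↦ z (f 0), …, z ↦ z (f (n-1))` satisfy a non-trivial polynomial relation on `W`:
there is `P ∈ K[Y_1, …, Y_n]`, `P ≠ 0`, with `P(z ∘ f) = 0` for every `z ∈ W`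
(`exists_mvPolynomial_relation_of_zariskiDim_lt`). In particular on a set of dimension `< 2`
any two coordinates are algebraically dependent (`exists_relation_pair_of_zariskiDim_lt_two`).

Proof: if not, `K[Y] → K[X_ι] ⧸ I(W)`, `Y_k ↦ X_{f k}`, is injective; a prime `𝔭` of the
coordinate ring avoiding the image of `K[Y] ∖ 0` exists (`Ideal.exists_le_prime_disjoint`), and
`K[Y]` still embeds into the affine domain `K[X_ι] ⧸ I(W) ⧸ 𝔭`, whose Krull dimension is its
transcendence degree (`Literature.RingTheory.KrullDimension.ringKrullDim_eq_trdeg`, Matsumura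
Thm 5.6) `≥ n` — contradicting `dim ≤ dim (K[X_ι] ⧸ I(W)) < n`. [folklore]

## References

* H. Matsumura, *Commutative Ring Theory*, CUP 1986, Thm 5.6 (dimension of affine domains).
-/

noncomputable section

open MvPolynomial

namespace Literature.NumberTheory.Transcendental

variable {K : Type*} [Field K] {ι : Type*} [Finite ι]

/-- **`n` coordinates on a set of Zariski dimension `< n` are algebraically dependent.**
If `zariskiDim K W < n` then for every `f : Fin n → ι` there is a non-zero
`P ∈ K[Y_0, …, Y_{n-1}]` with `P (z ∘ f) = 0` for all `z ∈ W`. [folklore]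
[cite: Matsumura1987, Thm 5.6] -/
theorem exists_mvPolynomial_relation_of_zariskiDim_lt (W : Set (ι → K)) {n : ℕ}
    (hW : zariskiDim K W < n) (f : Fin n → ι) :
    ∃ P : MvPolynomial (Fin n) K, P ≠ 0 ∧ ∀ z ∈ W, MvPolynomial.eval (z ∘ f) P = 0 := by
  classical
  by_contra hcon
  push Not at hcon
  -- the coordinate ring and the map `K[Y] → K[X] ⧸ I(W)`
  set J : Ideal (MvPolynomial ι K) := vanishingIdeal K W with hJ
  set A := MvPolynomial ι K ⧸ J with hA
  let φ : MvPolynomial (Fin n) K →ₐ[K] A := (Ideal.Quotient.mkₐ K J).comp (rename f)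
  have hφ : ∀ P, φ P = Ideal.Quotient.mk J (rename f P) := fun P => rfl
  -- `φ` is injective
  have hinj : ∀ P, φ P = 0 → P = 0 := by
    intro P hP
    by_contra hP0
    obtain ⟨z, hzW, hz⟩ := hcon P hP0
    rw [hφ, Ideal.Quotient.eq_zero_iff_mem, hJ, mem_vanishingIdeal_iff] at hP
    have h := hP z hzW
    rw [aeval_rename] at h
    exact hz h
  -- a prime of `A` avoiding the image of the non-zero polynomials
  let S : Submonoid A := (nonZeroDivisors (MvPolynomial (Fin n) K)).map φ
  have hS0 : (0 : A) ∉ S := by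
    rintro ⟨P, hP, hP0⟩
    exact nonZeroDivisors.ne_zero hP (hinj P hP0)
  have hdisj : Disjoint ((⊥ : Ideal A) : Set A) S := by
    rw [Set.disjoint_iff]
    rintro a ⟨ha, haS⟩
    have : a = 0 := by simpa using ha
    exact hS0 (this ▸ haS)
  obtain ⟨𝔭, h𝔭, -, h𝔭S⟩ := Ideal.exists_le_prime_disjoint (⊥ : Ideal A) S hdisj
  -- `K[Y]` embeds into the affine domain `A ⧸ 𝔭`
  set B := A ⧸ 𝔭 with hB
  haveI : IsDomain B := Ideal.Quotient.isDomain 𝔭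
  let ψ : MvPolynomial (Fin n) K →ₐ[K] B := (Ideal.Quotient.mkₐ K 𝔭).comp φ
  have hψ : Function.Injective ψ := by
    rw [injective_iff_map_eq_zero]
    intro P hP
    by_contra hP0
    have hmem : φ P ∈ 𝔭 := by
      change Ideal.Quotient.mk 𝔭 (φ P) = 0 at hP
      exact Ideal.Quotient.eq_zero_iff_mem.1 hP
    have hPS : φ P ∈ S := ⟨P, mem_nonZeroDivisors_of_ne_zero hP0, rfl⟩
    exact Set.disjoint_left.1 h𝔭S hmem hPS
  -- hence `n ≤ trdeg_K B = dim B ≤ dim A = zariskiDim K W`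
  have hind : AlgebraicIndependent K (fun k : Fin n => ψ (X k)) := by
    rw [algebraicIndependent_iff_injective_aeval]
    have : aeval (fun k : Fin n => ψ (X k)) = ψ := MvPolynomial.algHom_ext fun k => by simp
    rw [this]; exact hψ
  haveI : Algebra.FiniteType K A :=
    Algebra.FiniteType.of_surjective (Ideal.Quotient.mkₐ K J) (Ideal.Quotient.mkₐ_surjective K J)
  haveI : Algebra.FiniteType K B :=
    Algebra.FiniteType.trans (S := A) inferInstance
      (Algebra.FiniteType.of_surjective (Ideal.Quotient.mkₐ A 𝔭) (Ideal.Quotient.mkₐ_surjective A 𝔭))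
  have htr : (n : Cardinal) ≤ Algebra.trdeg K B := by
    have h := hind.lift_cardinalMk_le_trdeg
    rw [Cardinal.mk_fin, Cardinal.lift_natCast] at h
    have hfin : Algebra.trdeg K B = Cardinal.toNat (Algebra.trdeg K B) :=
      Literature.RingTheory.KrullDimension.trdeg_eq_toNat K B
    rw [hfin, Cardinal.lift_natCast] at h
    rw [hfin]; exact h
  have hdimB : (n : WithBot ℕ∞) ≤ ringKrullDim B := by
    rw [Literature.RingTheory.KrullDimension.ringKrullDim_eq_trdeg K B]
    have hfin : Algebra.trdeg K B = Cardinal.toNat (Algebra.trdeg K B) :=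
      Literature.RingTheory.KrullDimension.trdeg_eq_toNat K B
    rw [hfin] at htr
    exact_mod_cast htr
  have hBA : ringKrullDim B ≤ ringKrullDim A := ringKrullDim_quotient_le 𝔭
  have hAW : ringKrullDim A = zariskiDim K W := rfl
  exact absurd (hdimB.trans (hBA.trans hAW.le)) (not_le.2 hW)

/-- **Two coordinates on a set of Zariski dimension `< 2` are algebraically dependent**: for
`zariskiDim K W < 2` and any `p q : ι` there is `P ∈ K[Y_0, Y_1]`, `P ≠ 0`, with
`P (z p, z q) = 0` for all `z ∈ W`. [folklore] [cite: Matsumura1987, Thm 5.6] -/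
theorem exists_relation_pair_of_zariskiDim_lt_two (W : Set (ι → K)) (hW : zariskiDim K W < 2)
    (p q : ι) :
    ∃ P : MvPolynomial (Fin 2) K, P ≠ 0 ∧ ∀ z ∈ W, MvPolynomial.eval ![z p, z q] P = 0 := by
  obtain ⟨P, hP, h⟩ := exists_mvPolynomial_relation_of_zariskiDim_lt W (n := 2) hW ![p, q]
  refine ⟨P, hP, fun z hz => ?_⟩
  have hfun : (![z p, z q] : Fin 2 → K) = z ∘ ![p, q] := by
    funext k; fin_cases k <;> rfl
  rw [hfun]
  exact h z hz

end Literature.NumberTheory.Transcendental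

end
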